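import Summits.QuantumFields.BalabanUV.T4Continuum.Support.NE7HintOfLocalChartWideDecSlice
import Summits.QuantumFields.BalabanUV.T4Continuum.Support.NE7ConvOneStepGenericSlice
import Summits.QuantumFields.BalabanUV.T4Continuum.Support.NE7EnergyClassPoincareGeneric
import HarnessLib

/-!
# NE7HintOfLocalChartGenericWide — PORT MAP P2, FILE 1: (8)∃ FROM THE LOCAL CHART ON THE WIDE COVER FOR EVERY UNITARY GAUGE GROUP `U(n)` AND EVERY BLOCK SIZE `L ≥ 2` ON T⁴ —
# `NE7HintOfLocalChartSU2WideDecSlice.hint_of_localChart_SU2_wide` (F286w, `card n = 2`, `L = 2`, constant `8·CPLine 4 2 2 10⁻¹⁷ 10⁻⁵³ + 1`, radius `10⁻⁵³`) RE-ISSUED GENERICALLY: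
# the generic core `NE7HintOfLocalChartWideDecSlice.hint_of_localChart_wide` (any `d, L, n`) fed with THIS generation's class package (`NE7EnergyClassPoincareGeneric.classPackage`:
# the level family and the class slice-Poincaré inequality of `𝒯_E` for all `(d, L, n)`) and gen 99's generic `hT_energyBlockLandau`

Cell `pub-balaban`, rung (B)+1 sub-cell t4, lineage `b2b-balaban-t4-ne7-p1`, generation 109 (CRUX PROVER NE7 #1 = OWNER of BINDER row NE7).  Memo
`t4/b2b-balaban-t4-ne7-p1-g109/ROAD-G109.md` §3 (PORT MAP (card n = 2, L = 2) ⟶ (any n, any L); this is item P2.1; recipe: `2 ↦ L`, `8·CPLine…+1 ↦ C_E` (existential, `0 < C_E`, depending on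
`L, card n` only), `10⁻⁵³ ↦` the package radius, `hn ↦` nothing).
WHAT ([folklore]; 0 def, 0 sorry).  **`hint_of_localChart_generic_wide`**: for every `L ≥ 2`, `A ≥ 0`, `p`: `∃ C_E > 0, ∃ ℓ ≥ 1, ∃ ε₀ > 0, ∀ 0 < ε ≤ ε₀, ∃ β₀ > 0, ∀ 0 < β ≤ β₀, ∀ N ≥ 1, ∀ Kc ≥ 4ℓ + 12,
∀ C₀ C₁ αh νh κh`: IF the ONE k-free strict line (with `C_E`), the chart constants `C₀, C₁ ≤ A(ℓ+1)^p`, THE CHART on the `Kc`-fold cover (bond-wise `U^{u} = e^{At}` on the sup-ball of radius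
`(nbRad 4 L + 2ℓ + 10)·L^{k+1}`, `‖At‖ ≤ a₀`, `‖∇At‖ ≤ a₁`, `L^{k+1}a₀ ≤ C₀t`, `L^{2(k+1)}a₁ ≤ C₁t`) and the honest per-pair binder `hdecomp` over the corner-free energy block-Landau slice
`𝒯_E = energyBlockLandauW L N (k+1) Us` hold, THEN for some `δ_V > 0`, over `{V | unitary, N-periodic, SmallField V δ_V}`, at every level some constrained minimiser over `sfClass 4 L N ε`
is `SmallField U a` with `0 ≤ a < ε∕(L^k)²` — F286w's statement TOKEN FOR TOKEN under the recipe.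
HONEST FRAMING (page 1): composition of landed kernel theorems (gen 95∕99 generic core, gen 99 `hT_energyBlockLandau`, gen 109 class package); constants existential; nothing of Bałaban's
asserted; THE CHART, `hdecomp` and the strict line REMAIN HYPOTHESES here exactly as in F286w (discharged downstream in the SU(2) record by files P2.2–P2.6 of the PORT MAP, whose generic
re-issue is the next step); NE7 NOT proved; spine 0∕9; finite T⁴ rung (B)+1 — NOT infinite volume, NOT mass gap, NOT BetaPertH, NOT Clay (continuum YM on T⁴ ⇐ BetaPertH ∧ nine spine estimates).
-/

set_option autoImplicit false

open scoped BigOperators Matrix Matrix.Norms.L2Operator Topology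
open NormedSpace Finset Set Filter

namespace Summit.QuantumFields.BalabanUV.T4Continuum.NE7HintOfLocalChartGenericWide

open Literature.MathematicalPhysics.QuantumFieldTheory.Balaban1983to89
open B7Prop1Explicit B7Prop2Explicit MatrixLog UnitaryModel
open B4TorusKernel.MultiPeriod (torusSupNorm)
open T4AveragingDeficitWall (IsUnitaryCfg IsSkewDir SmallField vary curl curlSq dirSq dirL1)
open T4AveragingDeficitWallBoundary (IsPeriodicCfg periodBox)
open AveragingDeficitPeriodicCounting (IsPeriodicDir)
open AveragingDeficitMultiLevelPrep (LevelSmall tower TangentIter)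
open BlockAverageVaryHolo (nbRad)
open MinimalActionLevels (perWin)
open MinimalActionSandwich (IsMinimiser admissible)
open MinimalActionRate (sfClass)
open NE3HessForm (dAction)
open NE3SlicePoincareShape (SlicePoincare slicePoincare_mono)
open NE7MeanZeroGaugeSliceW (energyBlockLandauW)
open NE7ConvOneStepGenericSlice (hT_energyBlockLandau)
open NE3EnergyShapes (IsUnitarySite)
open BlockAveragePushDirSplit (flat)
open NE7HintOfLocalChartWideDecSlice (hint_of_localChart_wide)
open NE7EnergyClassPoincareGeneric (classPackage)
open NE3EnergyWeightedShapes (energyNormW)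

variable {n : Type*} [Fintype n] [DecidableEq n]

set_option maxHeartbeats 400000 in
/-- **P2.1 — (8)∃ from the local chart on the WIDE cover, EVERY `U(n)`, EVERY `L ≥ 2`, on T⁴** (statement in the file header; F286w generic). [folklore] -/
theorem hint_of_localChart_generic_wide [Nonempty n] {L : ℕ} (hL : 2 ≤ L) {A : ℝ} (hA : 0 ≤ A) (p : ℕ) :
    ∃ CE : ℝ, 0 < CE ∧ ∃ ℓ : ℕ, 1 ≤ ℓ ∧ ∃ ε₀ : ℝ, 0 < ε₀ ∧ ∀ ε : ℝ, 0 < ε → ε ≤ ε₀ → ∃ β₀ : ℝ, 0 < β₀ ∧ ∀ β : ℝ, 0 < β → β ≤ β₀ →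
    ∀ (N : ℕ) [NeZero N] (Kc : ℕ) (C₀ C₁ αh νh κh : ℝ), 1 ≤ N → 4 * ℓ + 12 ≤ Kc →
    -- the k-free ceilings `(α̂, ν̂, κ̂)` of the honest per-pair binder and ONE k-free strict line (F327)
    2 * κh < ((((1 / 2 - νh ^ 2) / (2 * (1 + CE)) - νh ^ 2) / 2 - 576 * ((4 : ℕ) : ℝ) * (αh ^ 2 * Real.exp (2 * αh))) / (Fintype.card n : ℝ) - 28 * ((4 : ℕ) : ℝ) * (ε + 7 * αh ^ 2)) →
    0 ≤ C₀ → C₀ ≤ A * ((ℓ : ℝ) + 1) ^ p → 0 ≤ C₁ → C₁ ≤ A * ((ℓ : ℝ) + 1) ^ p →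
    (∀ D : Site 4 → Fin 4 → (Matrix n n ℂ)ˣ, IsUnitaryCfg D → IsPeriodicCfg D ((N * Kc) : ℤ) → SmallField D (4 * (Real.exp β - 1)) →
      ∀ (k : ℕ), ∀ U ∈ admissible (sfClass 4 L (N * Kc) ε) L (k + 1) D,
      (∀ φ : Site 4 → Fin 4 → Matrix n n ℂ, IsSkewDir φ → IsPeriodicDir φ (((N * Kc) * L ^ (k + 1) : ℕ) : ℤ) → TangentIter L k U φ →
        dAction U φ (perWin 4 ((N * Kc) * L ^ (k + 1))) = 0) →
      ∀ r : ℝ, 0 ≤ r → r ≤ (1 / (L : ℝ) ^ 2 * ε) → SmallField U (r / ((L : ℝ) ^ (k + 1)) ^ 2) →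
      ∀ z : Site 4, ∃ (u : Site 4 → (Matrix n n ℂ)ˣ) (At : Site 4 → Fin 4 → Matrix n n ℂ) (a₀ a₁ : ℝ),
        IsUnitarySite u ∧ (∀ (y : Site 4) (i : Fin 4), u (y + (((N * Kc) * L ^ (k + 1) : ℕ) : ℤ) • e i) = u y) ∧
        IsSkewDir At ∧ IsPeriodicDir At (((N * Kc) * L ^ (k + 1) : ℕ) : ℤ) ∧ 0 ≤ a₀ ∧ 0 ≤ a₁ ∧
        (∀ (y : Site 4) (κ : Fin 4), ‖At y κ‖ ≤ a₀) ∧ (∀ (y : Site 4) (κ τ : Fin 4), ‖At (y + e τ) κ - At y κ‖ ≤ a₁) ∧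
        (L : ℝ) ^ (k + 1) * a₀ ≤ C₀ * (r + 4 * (Real.exp β - 1) + ε) ∧ ((L : ℝ) ^ (k + 1)) ^ 2 * a₁ ≤ C₁ * (r + 4 * (Real.exp β - 1) + ε) ∧
        (∀ (y : Site 4) (κ : Fin 4),
          torusSupNorm (fun _ : Fin 4 => L ^ (k + 1) * (N * Kc)) (y - z) ≤ (((nbRad 4 L + 2 * ℓ + 10) * L ^ (k + 1) : ℕ) : ℝ) →
            gaugeAct u U y κ = vary (flat (d := 4) (n := n)) At 1 y κ)) →
    (∀ D : Site 4 → Fin 4 → (Matrix n n ℂ)ˣ, IsUnitaryCfg D → IsPeriodicCfg D (N : ℤ) → SmallField D (4 * (Real.exp β - 1)) → ∀ (k : ℕ), ∀ Us ∈ admissible (sfClass 4 L N ε) L (k + 1) D, SmallField Us ((1 / (L : ℝ) ^ 2 * ε / 2) / ((L : ℝ) ^ (k + 1)) ^ 2) → (∀ φ : Site 4 → Fin 4 → Matrix n n ℂ, IsSkewDir φ → IsPeriodicDir φ ((N * L ^ (k + 1) : ℕ) : ℤ) → TangentIter L k Us φ → dAction Us φ (perWin 4 (N * L ^ (k + 1)))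 = 0) → ∀ U' ∈ admissible (sfClass 4 L N ε) L (k + 1) D,
      ∃ (u : Site 4 → (Matrix n n ℂ)ˣ) (X XT XN : Site 4 → Fin 4 → Matrix n n ℂ) (α ν κ : ℝ),
        IsUnitarySite u ∧ IsSkewDir X ∧ IsPeriodicDir X ((N * L ^ (k + 1) : ℕ) : ℤ) ∧ 0 ≤ α ∧ (∀ x μ, ‖X x μ‖ ≤ α) ∧
        gaugeAct u U' = vary Us X 1 ∧
        X = XT + XN ∧ XT ∈ energyBlockLandauW (d := 4) (n := n) L N (k + 1) Us ∧ IsSkewDir XN ∧ 0 ≤ ν ∧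
        energyNormW L (k + 1) Us XN (periodBox (d := 4) (N * L ^ (k + 1)))
          ≤ ν * energyNormW L (k + 1) Us X (periodBox (d := 4) (N * L ^ (k + 1))) ∧
        ε / ((L : ℝ) ^ (k + 1)) ^ 2 * (∑ p ∈ perWin 4 (N * L ^ (k + 1)), ‖curl Us XN p‖)
          ≤ κ * energyNormW L (k + 1) Us X (periodBox (d := 4) (N * L ^ (k + 1))) ^ 2 ∧
        α * (L : ℝ) ^ (k + 1) ≤ αh ∧ ν ≤ νh ∧ κ ≤ κh) →
    ∃ δV : ℝ, 0 < δV ∧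
      ∀ V ∈ {V : Site 4 → Fin 4 → (Matrix n n ℂ)ˣ | IsUnitaryCfg V ∧ IsPeriodicCfg V (N : ℤ) ∧ SmallField V δV},
      ∀ k : ℕ, ∃ U : Site 4 → Fin 4 → (Matrix n n ℂ)ˣ, IsMinimiser 4 (sfClass 4 L N ε) L N k V U ∧
        ∃ a : ℝ, 0 ≤ a ∧ a < ε / ((L : ℝ) ^ k) ^ 2 ∧ SmallField U a := by
  haveI : NeZero L := ⟨by omega⟩
  obtain ⟨θ₀, CF, CE, hθ₀, -, -, hCE, -, -, hls, -, hPE⟩ := classPackage (n := n) (d := 4) (by norm_num) hL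
  obtain ⟨ℓ, hℓ1, ε₀, hε₀, H⟩ := hint_of_localChart_wide (d := 3) (n := n) (L := L) hL hA p
  refine ⟨CE + 1, by linarith, ℓ, hℓ1, min ε₀ θ₀, lt_min hε₀ hθ₀, fun ε hε hεle => ?_⟩
  obtain ⟨β₀, hβ₀, H2⟩ := H ε hε (hεle.trans (min_le_left _ _))
  refine ⟨β₀, hβ₀, ?_⟩
  intro β hβ hβle N _ Kc C₀ C₁ αh νh κh hN hKc hline hC₀ hC₀b hC₁ hC₁b hchart hdecomp
  have hε' : ε ≤ θ₀ := hεle.trans (min_le_right _ _)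
  have hls' : ∀ k : ℕ, LevelSmall 4 L k (ε / ((L : ℝ) ^ (k + 1)) ^ 2) := hls hε.le hε'
  exact H2 β hβ hβle N Kc (CE + 1) C₀ C₁ αh νh κh hN hKc (by linarith) hls'
    (fun j W => energyBlockLandauW (d := 4) (n := n) L N (j + 1) W)
    (fun j W hW F htan => hT_energyBlockLandau (by omega) hε.le hls' j W hW F htan)
    (fun j W hW => slicePoincare_mono (hPE hN hε hε' j W hW) (by linarith))
    hline hC₀ hC₀b hC₁ hC₁b hchart hdecomp

end Summit.QuantumFields.BalabanUV.T4Continuum.NE7HintOfLocalChartGenericWide
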